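import Mathlib
import Summits.Parity.GeneralizedHardyLittlewood.Theorems.LiouvilleShiftedTablesEHStubBadModuliSparse

/-!
# Bad moduli: a harmonic bound linear in `#I`

Stub `stub_badModuliHarmonic` of the line `upward-replication-free-factorability` (log-sparse
variant) for the crux `EH` (route `LiouvilleShiftedTables`, summit
`Parity/GeneralizedHardyLittlewood`).

Fix `0 < ε'` and a level exponent `θ` with `κ := 1 − ε' − θ > 0`.  A modulus `q ≤ x^θ` is *bad*
for a set `I ⊆ ℕ` when every prime `p ∤ q` of the window `(x^{1−ε'}/q, 2x^{1−ε'}/q]` has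
`q·p ∈ I`.  Then, with no hypothesis on the size of `I`,
`∑_{q bad} 1/φ(q) ≤ K · #I · x^{−(1−ε')} (log x)²` for `x ≥ x₁(ε', θ)`, where
`K = 10 (3⁹ + 4e⁵)/κ`.

Proof (elementary counting + the prime number theorem), word for word the argument of the sibling
stub `Summit.Parity.GeneralizedHardyLittlewood.Theorems.EH.BadModuliSparse.stub_badModuliSparse`,
whose helper lemmas are reused:
* primes: with `P := x^{1−ε'}/q ≥ x^κ`, the window `(P, 2P]` contains `≥ P/(4 log x)` primes
  (`BadModuliSparse.exists_window_primes`, from `ϑ(x) ~ x`), of which `≤ 2/κ` divide `q`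
  (`BadModuliSparse.card_filter_primeFactors_le`: a positive integer `m ≤ x²` has `≤ 2/κ` prime
  factors `> x^κ`); so each bad `q` has `≥ P/(5 log x)` admissible primes once
  `40 log x ≤ κ x^κ` (`BadModuliSparse.eventually_conds`);
* pairs: `(q, p) ↦ q·p ∈ I` has fibres of size `≤ 2/κ` (`p > x^κ` is a prime factor of
  `q·p ≤ 2x ≤ x²` and determines `q`), so `∑_{bad} #A(q) ≤ (2/κ)·#I`;
* weights: `1/q ≤ (5 log x/x^{1−ε'})·#A(q)` and `q/φ(q) ≤ (3⁹ + 4e⁵) log x`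
  (`BadModuliSparse.totient_inv_le`), whence
  `∑_{bad} 1/φ(q) ≤ (10 (3⁹ + 4e⁵)/κ) · #I · x^{−(1−ε')} (log x)²`.

References: H. L. Montgomery, R. C. Vaughan, *Multiplicative Number Theory I*, CUP 2007, §8.1
(prime number theorem for `ϑ`), §2.3 (order of `n/φ(n)`).
-/

noncomputable section

open Filter Finset Real
open Summit.Parity.GeneralizedHardyLittlewood.Theorems.EH.BadModuliSparse

namespace Summit.Parity.GeneralizedHardyLittlewood.Theorems.EH.BadModuliHarmonic

/-- **Bad moduli: harmonic bound linear in `#I`** (stub `stub_badModuliHarmonic` of the line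
`upward-replication-free-factorability`, log-sparse variant, crux `EH`).  Call `q ≤ x^θ` bad for
`I` when every prime `p ∤ q` of `(x^{1−ε'}/q, 2x^{1−ε'}/q]` has `q·p ∈ I`.  If
`κ = 1 − ε' − θ > 0`, then `∑_{q bad} 1/φ(q) ≤ K · #I · x^{−(1−ε')} (log x)²` for `x ≥ x₁`, with
`K = 10 (3⁹ + 4e⁵)/κ` and no hypothesis on `#I`: each bad `q` has `≥ x^{1−ε'}/(5 q log x)`
admissible primes (prime number theorem in `(P, 2P]` minus the `≤ 2/κ` prime factors of `q`
exceeding `x^κ`), the map `(q, p) ↦ q·p ∈ I` is at most `(2/κ)`-to-one, and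
`q/φ(q) ≤ (3⁹ + 4e⁵) log x`.
[cite: MontgomeryVaughan2007, §8.1 eq. (8.3)] -/
theorem stub_badModuliHarmonic :
    ∀ ε' θ : ℝ, 0 < ε' → 0 < 1 - ε' - θ →
      ∃ K x₁ : ℝ, ∀ x : ℝ, x₁ ≤ x → ∀ I : Finset ℕ,
        ∀ Bad : Finset ℕ, Bad ⊆ Finset.Icc 1 ⌊x ^ θ⌋₊ →
          (∀ q ∈ Bad, ∀ p : ℕ, p.Prime → ¬ p ∣ q →
              x ^ (1 - ε') / q < p → (p : ℝ) ≤ 2 * x ^ (1 - ε') / q → q * p ∈ I) →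
            ∑ q ∈ Bad, ((Nat.totient q : ℝ))⁻¹ ≤
              K * (I.card : ℝ) / x ^ (1 - ε') * Real.log x ^ 2 := by
  intro ε' θ hε' hκ
  set κ := 1 - ε' - θ with hκdef
  set C : ℝ := 3 ^ 9 + 4 * Real.exp 5 with hCdef
  have hC0 : 0 < C := by positivity
  obtain ⟨P₀, hP₀⟩ := exists_window_primes
  obtain ⟨x₁, hx₁⟩ := Filter.eventually_atTop.1 (eventually_conds P₀ hκ)
  refine ⟨10 * C / κ, x₁, ?_⟩
  intro x hx I Bad hBad hmem
  obtain ⟨hx8, hlog1, hP₀x, hlogx⟩ := hx₁ x hx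
  set L := Real.log x with hLdef
  set X := x ^ (1 - ε') with hXdef
  have hx1 : 1 < x := by linarith
  have hL0 : 0 < L := by linarith
  have hX0 : 0 < X := Real.rpow_pos_of_pos (by linarith) _
  have hXx : X ≤ x := by
    simpa using Real.rpow_le_rpow_of_exponent_le hx1.le (by linarith : 1 - ε' ≤ 1)
  have hx2 : x ^ θ ≤ x ^ (2 : ℝ) := Real.rpow_le_rpow_of_exponent_le hx1.le (by linarith)
  have hxθ : x ^ θ ≤ x := by
    simpa using Real.rpow_le_rpow_of_exponent_le hx1.le (by linarith : θ ≤ 1)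
  -- the window primes of `q` and the admissible ones
  set Pr : ℕ → Finset ℕ := fun q => (Finset.Ioc ⌊X / q⌋₊ ⌊2 * (X / q)⌋₊).filter Nat.Prime
    with hPrdef
  set A : ℕ → Finset ℕ := fun q => (Pr q).filter (fun p => ¬ p ∣ q) with hAdef
  have hq : ∀ q ∈ Bad, 1 ≤ q ∧ (q : ℝ) ≤ x ^ θ := fun q hqB =>
    ⟨(Finset.mem_Icc.1 (hBad hqB)).1,
      (Nat.le_floor_iff (Real.rpow_nonneg (by linarith) θ)).1 (Finset.mem_Icc.1 (hBad hqB)).2⟩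
  have hPq : ∀ q ∈ Bad, x ^ κ ≤ X / q := by
    intro q hqB
    obtain ⟨hq1, hqθ⟩ := hq q hqB
    rw [le_div_iff₀ (by exact_mod_cast hq1 : (0 : ℝ) < q)]
    calc x ^ κ * q ≤ x ^ κ * x ^ θ := mul_le_mul_of_nonneg_left hqθ (Real.rpow_nonneg (by linarith) κ)
      _ = X := by rw [hXdef, ← Real.rpow_add (by linarith), hκdef]; ring_nf
  -- (1) each bad `q` has many admissible primes
  have key1 : ∀ q ∈ Bad, X / q ≤ 5 * L * ((A q).card : ℝ) := by
    intro q hqB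
    obtain ⟨hq1, hqθ⟩ := hq q hqB
    have hP := hPq q hqB
    have hq0 : (0 : ℝ) < q := by exact_mod_cast hq1
    have h1 := hP₀ (X / q) (hP₀x.trans hP)
    have h2 : Real.log (2 * (X / q)) ≤ 2 * L := by
      have hXq : X / q ≤ X := div_le_self hX0.le (by exact_mod_cast hq1)
      have h22 : 2 * (X / q) ≤ x ^ 2 := by nlinarith
      calc Real.log (2 * (X / q)) ≤ Real.log (x ^ 2) := Real.log_le_log (by positivity) h22
        _ = 2 * L := by rw [Real.log_pow]; push_cast; ring
    have h3 : X / q / 4 ≤ ((Pr q).card : ℝ) * L := by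
      have := mul_le_mul_of_nonneg_left h2 (Nat.cast_nonneg (Pr q).card)
      linarith
    have h4 : (((Pr q).filter (· ∣ q)).card : ℝ) ≤ 2 / κ := by
      have hsub : (Pr q).filter (· ∣ q) ⊆ q.primeFactors.filter (fun p : ℕ => x ^ κ < (p : ℝ)) := by
        intro p hp
        simp only [hPrdef, Finset.mem_filter, Finset.mem_Ioc] at hp
        obtain ⟨⟨⟨hp1, -⟩, hpp⟩, hpq⟩ := hp
        refine Finset.mem_filter.2 ⟨Nat.mem_primeFactors.2 ⟨hpp, hpq, by omega⟩, ?_⟩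
        exact hP.trans_lt (Nat.lt_of_floor_lt hp1)
      calc (((Pr q).filter (· ∣ q)).card : ℝ)
          ≤ ((q.primeFactors.filter (fun p : ℕ => x ^ κ < (p : ℝ))).card : ℝ) := by
            exact_mod_cast Finset.card_le_card hsub
        _ ≤ 2 / κ := card_filter_primeFactors_le hx1 hκ (by omega) (hqθ.trans hx2)
    have h5 : (((Pr q).filter (· ∣ q)).card : ℝ) + ((A q).card : ℝ) = ((Pr q).card : ℝ) := by
      exact_mod_cast Finset.card_filter_add_card_filter_not (s := Pr q) (· ∣ q)
    have h6 : 40 * L ≤ κ * (X / q) := hlogx.trans (mul_le_mul_of_nonneg_left hP hκ.le)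
    have h7 : (((Pr q).filter (· ∣ q)).card : ℝ) * L ≤ X / q / 20 := by
      have h71 : (((Pr q).filter (· ∣ q)).card : ℝ) * L ≤ 2 / κ * L :=
        mul_le_mul_of_nonneg_right h4 hL0.le
      have h72 : 2 / κ * L ≤ X / q / 20 := by
        rw [div_mul_eq_mul_div, div_le_iff₀ hκ]
        linarith
      linarith
    have h8 : ((Pr q).card : ℝ) * L =
        (((Pr q).filter (· ∣ q)).card : ℝ) * L + ((A q).card : ℝ) * L := by
      rw [← h5]; ring
    linarith
  -- (2) the pairs `(q, p)`, `p` admissible for `q`, inject `(2/κ)`-to-one into `I`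
  set S := Bad.sigma A with hSdef
  have hmaps : ∀ a ∈ S, (fun a : (Σ _ : ℕ, ℕ) => a.1 * a.2) a ∈ I := by
    rintro ⟨q, p⟩ ha
    simp only [hSdef, Finset.mem_sigma, hAdef, hPrdef, Finset.mem_filter, Finset.mem_Ioc] at ha
    obtain ⟨hqB, ⟨⟨hp1, hp2⟩, hpp⟩, hpq⟩ := ha
    obtain ⟨hq1, -⟩ := hq q hqB
    refine hmem q hqB p hpp hpq (Nat.lt_of_floor_lt hp1) ?_
    rw [mul_div_assoc]
    exact (Nat.le_floor_iff (by positivity)).1 hp2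
  have hfib : ∀ m ∈ I, (S.filter (fun a => a.1 * a.2 = m)).card ≤ ⌊2 / κ⌋₊ := by
    intro m _
    rcases (S.filter (fun a => a.1 * a.2 = m)).eq_empty_or_nonempty with h | ⟨⟨q₀, p₀⟩, h₀⟩
    · simp [h]
    simp only [hSdef, Finset.mem_filter, Finset.mem_sigma, hAdef, hPrdef, Finset.mem_Ioc] at h₀
    obtain ⟨⟨hqB, ⟨⟨-, hp2⟩, hpp⟩, -⟩, hm⟩ := h₀
    obtain ⟨hq1, -⟩ := hq q₀ hqB
    have hq0 : (0 : ℝ) < q₀ := by exact_mod_cast hq1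
    have hm0 : m ≠ 0 := by rw [← hm]; exact Nat.mul_ne_zero (by omega) hpp.ne_zero
    have hmx : (m : ℝ) ≤ x ^ (2 : ℝ) := by
      have hp2' : (p₀ : ℝ) ≤ 2 * (X / q₀) := (Nat.le_floor_iff (by positivity)).1 hp2
      have hmc : (m : ℝ) = q₀ * p₀ := by rw [← hm]; push_cast; ring
      rw [hmc, Real.rpow_two]
      calc (q₀ : ℝ) * p₀ ≤ q₀ * (2 * (X / q₀)) := mul_le_mul_of_nonneg_left hp2' hq0.le
        _ = 2 * X := by field_simp
        _ ≤ x ^ 2 := by nlinarith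
    have hinj : (S.filter (fun a => a.1 * a.2 = m)).card ≤
        (m.primeFactors.filter (fun p : ℕ => x ^ κ < (p : ℝ))).card := by
      refine Finset.card_le_card_of_injOn (fun a : (Σ _ : ℕ, ℕ) => a.2) ?_ ?_
      · rintro ⟨q, p⟩ ha
        simp only [Finset.coe_filter, Set.mem_setOf_eq, hSdef, Finset.mem_sigma, hAdef, hPrdef,
          Finset.mem_filter, Finset.mem_Ioc] at ha
        obtain ⟨⟨hqB', ⟨⟨hp1', -⟩, hpp'⟩, -⟩, hm'⟩ := ha
        simp only [Finset.coe_filter, Set.mem_setOf_eq]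
        exact ⟨Nat.mem_primeFactors.2 ⟨hpp', Dvd.intro_left q hm', hm0⟩,
          (hPq q hqB').trans_lt (Nat.lt_of_floor_lt hp1')⟩
      · rintro ⟨q, p⟩ ha ⟨q', p'⟩ ha' hpp
        simp only [Finset.coe_filter, Set.mem_setOf_eq, hSdef, Finset.mem_sigma, hAdef, hPrdef,
          Finset.mem_filter, Finset.mem_Ioc] at ha ha' hpp
        subst hpp
        have hp0 : 0 < p := ha.1.2.1.2.pos
        have hqq : q = q' := Nat.eq_of_mul_eq_mul_right hp0 (ha.2.trans ha'.2.symm)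
        subst hqq
        rfl
    refine Nat.le_floor ?_
    calc ((S.filter (fun a => a.1 * a.2 = m)).card : ℝ)
        ≤ ((m.primeFactors.filter (fun p : ℕ => x ^ κ < (p : ℝ))).card : ℝ) := by
          exact_mod_cast hinj
      _ ≤ 2 / κ := card_filter_primeFactors_le hx1 hκ hm0 hmx
  have hS : S.card ≤ ⌊2 / κ⌋₊ * I.card := Finset.card_le_mul_card_image_of_maps_to hmaps _ hfib
  have key2 : (∑ q ∈ Bad, ((A q).card : ℝ)) ≤ 2 / κ * (I.card : ℝ) := by
    have h1 : (∑ q ∈ Bad, ((A q).card : ℝ)) = S.card := by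
      rw [hSdef, Finset.card_sigma]; push_cast; rfl
    rw [h1]
    calc (S.card : ℝ) ≤ (⌊2 / κ⌋₊ : ℝ) * I.card := by exact_mod_cast hS
      _ ≤ 2 / κ * I.card :=
          mul_le_mul_of_nonneg_right (Nat.floor_le (by positivity)) (Nat.cast_nonneg _)
  -- (3) weights and totients
  have hterm : ∀ q ∈ Bad, ((Nat.totient q : ℝ))⁻¹ ≤ (5 * C * L ^ 2 / X) * ((A q).card : ℝ) := by
    intro q hqB
    obtain ⟨hq1, hqθ⟩ := hq q hqB
    have hq0 : (0 : ℝ) < q := by exact_mod_cast hq1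
    have h1 := totient_inv_le hx8 hlog1 hq1 (hqθ.trans hxθ)
    have h2 := key1 q hqB
    calc ((Nat.totient q : ℝ))⁻¹ ≤ C * L / q := h1
      _ = (C * L / X) * (X / q) := by field_simp
      _ ≤ (C * L / X) * (5 * L * ((A q).card : ℝ)) :=
          mul_le_mul_of_nonneg_left h2 (by positivity)
      _ = (5 * C * L ^ 2 / X) * ((A q).card : ℝ) := by ring
  calc ∑ q ∈ Bad, ((Nat.totient q : ℝ))⁻¹
      ≤ ∑ q ∈ Bad, (5 * C * L ^ 2 / X) * ((A q).card : ℝ) := Finset.sum_le_sum hterm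
    _ = (5 * C * L ^ 2 / X) * ∑ q ∈ Bad, ((A q).card : ℝ) := by rw [Finset.mul_sum]
    _ ≤ (5 * C * L ^ 2 / X) * (2 / κ * (I.card : ℝ)) :=
        mul_le_mul_of_nonneg_left key2 (by positivity)
    _ = 10 * C / κ * (I.card : ℝ) / X * L ^ 2 := by ring

end Summit.Parity.GeneralizedHardyLittlewood.Theorems.EH.BadModuliHarmonic

end
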